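import Summits.QuantumAdvantage.QuantumAdvantage.Theorems.SosSandwichPseudoBoundedAALevelKRows
import Summits.QuantumAdvantage.QuantumAdvantage.Theorems.RandomOracleGaugeDecoupledCoreAAStubDerivativeFamily
import Summits.QuantumAdvantage.QuantumAdvantage.Theses.RandomOracleGauge
import Literature.Computability.QuantumComplexity.InfluenceBounds
import HarnessLib

/-!
# Crux `DecoupledCoreAA` (stmt-QuantumAdvantage-17872), line `l1-family`, stub `stub_l1Family` —
# the EXPONENTIAL-SCALE rung (what the open stub must beat), in kernel

`stub_l1Family` (`Cruxes/AAConj/Lines/l1_family.lean`, the only open stub upstream of `AAConj` (10748) and of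
`SosSandwich.PseudoBoundedAA` (15237, via `pseudoBoundedAA_of_decoupledCore`)) is the ℓ¹-FAMILY DICHOTOMY: an
ℓ¹-bounded family `g_1,…,g_N` of degree-`≤ d` cube polynomials (`Σ_i |g_i(z)| ≤ 1` pointwise) of total `L²`-mass
`V = Σ_i E[g_i²] ≥ 1/(K₀ d^κ₀)` has a member of mass `≥ C/d^c` OR a coordinate of aggregate influence `≥ C/d^c`.

This file lands the BASELINE the stub must beat, with explicit constants and no hypothesis beyond the stub's own:

* §1 `boolAvg_sq_le_of_totalDegree_le` / `sqrt_boolAvg_sq_le` — Khintchine from Bonami for a degree-`≤ d`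
  polynomial: `E[g²] ≤ 9^d (E|g|)²`, i.e. `‖g‖₂ ≤ 3^d ‖g‖₁` (the tree's `sq_sum_le_of_isLevelLE`, level `≤ d` from
  `cubeFourierCoeff_evalBool_eq_zero`); `sum_boolAvg_abs_le` — `Σ_i E|g_i| ≤ L` from the pointwise bound.
* §2 `exists_heavyMember_exp` — **the heavy-member alternative ALONE holds at exponential scale**: if
  `Σ_i |g_i(z)| ≤ L` pointwise then some member has `E[g_i²] ≥ V²/(9^d L²)` (`V = Σ_i E[g_i²] ≤ √(max_i E[g_i²])·3^d·L`).
* §3 `l1Family_heavyMember_expScale` — in the stub's regime `1 ≤ K₀ d^κ₀ V`: `∃ i, E[g_i²] ≥ 1/(K₀² d^{2κ₀} 9^d)`;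
  `l1Family_of_degree_le` — hence the registered statement of `stub_l1Family` restricted to `d ≤ D₀` holds for EVERY
  `D₀` with `(c, C) = (2κ₀, 1/(K₀² 9^{D₀}))` (first alternative only).
* §4 `decoupledCoreAA_expScale` — transported through the landed `stub_derivativeFamily`: every one-block-decoupled
  `[0,1]`-bounded `q` of degree `≤ d` with `1 ≤ K₀ d^κ₀ Var q` has a `y`-variable of influence
  `≥ 16/(K₀² d^{2κ₀} 9^d)`; `decoupledCoreAA_of_degree_le` — the crux decl's statement restricted to `d ≤ D₀`.

CALIBRATION, not progress on the open core: the content of `stub_l1Family` is exactly the replacement of `9^d` by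
`poly(d)`, and the line card's address family shows that at polynomial scale the first alternative alone is false —
so any proof must route mass to the coordinate alternative.  Honest label: no stub, crux or summit is closed here.
Sources: O'Donnell 2014 Thm. 9.21 (Bonami), §9.1; O'Donnell–Zhao arXiv:1512.01603 eqn. (2.1), Thm. 2.13;
Aaronson–Ambainis arXiv:0911.0996 Conj. 6.
-/

-- D-0017: single-conjunct summit ⇒ the duplicate `QuantumAdvantage.QuantumAdvantage` is mandated.
set_option linter.dupNamespace false

noncomputable section

open Finset
open Literature.Computability.QuantumComplexity
open Literature.Computability.Complexity.LowDegree (IsLevelLE)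
open Summit.QuantumAdvantage.QuantumAdvantage.Theorems.SosSandwich.LevelKRung (sq_sum_le_of_isLevelLE)
open Summit.QuantumAdvantage.QuantumAdvantage.Theses.RandomOracleGauge (DecoupledCoreAA)

namespace Summit.QuantumAdvantage.QuantumAdvantage.Cruxes.DecoupledCoreAA.L1Family.ExpRung

variable {N : ℕ}

/-! ### §1 Khintchine from Bonami for one polynomial; the averaged ℓ¹ bound -/

/-- The cube function of a polynomial of total degree `≤ d` has Fourier level `≤ d`.
[cite: ODonnell2014, §1.4] -/
theorem isLevelLE_evalBool {p : MvPolynomial (Fin N) ℝ} {d : ℕ} (hp : p.totalDegree ≤ d) :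
    IsLevelLE d (evalBool p) := fun _S hS => cubeFourierCoeff_evalBool_eq_zero hp hS

/-- **Khintchine from Bonami**, `boolAvg` form: `E[g²] ≤ 9^d · (E|g|)²` for a polynomial `g` of total degree `≤ d`
on the cube. [cite: ODonnell2014, Thm. 9.21] -/
theorem boolAvg_sq_le_of_totalDegree_le {p : MvPolynomial (Fin N) ℝ} {d : ℕ} (hp : p.totalDegree ≤ d) :
    boolAvg (fun z => evalBool p z ^ 2) ≤ (9 : ℝ) ^ d * (boolAvg fun z => |evalBool p z|) ^ 2 := by
  have h := sq_sum_le_of_isLevelLE (evalBool p) (isLevelLE_evalBool hp)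
  have h2N : (0 : ℝ) < (2 : ℝ) ^ N := by positivity
  unfold boolAvg
  calc (∑ z, evalBool p z ^ 2) / (2 : ℝ) ^ N
      = ((∑ z, evalBool p z ^ 2) * (2 : ℝ) ^ N) / ((2 : ℝ) ^ N * (2 : ℝ) ^ N) := by
        field_simp
    _ ≤ ((9 : ℝ) ^ d * (∑ z, |evalBool p z|) ^ 2) / ((2 : ℝ) ^ N * (2 : ℝ) ^ N) :=
        div_le_div_of_nonneg_right h (by positivity)
    _ = (9 : ℝ) ^ d * ((∑ z, |evalBool p z|) / (2 : ℝ) ^ N) ^ 2 := by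
        field_simp

/-- `‖g‖₂ ≤ 3^d ‖g‖₁`: square-root form of `boolAvg_sq_le_of_totalDegree_le`. [cite: ODonnell2014, Thm. 9.22] -/
theorem sqrt_boolAvg_sq_le {p : MvPolynomial (Fin N) ℝ} {d : ℕ} (hp : p.totalDegree ≤ d) :
    Real.sqrt (boolAvg fun z => evalBool p z ^ 2) ≤ (3 : ℝ) ^ d * boolAvg fun z => |evalBool p z| := by
  have h := boolAvg_sq_le_of_totalDegree_le hp
  have ha : 0 ≤ boolAvg fun z => |evalBool p z| := boolAvg_nonneg fun _ => abs_nonneg _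
  have h3 : (0 : ℝ) ≤ (3 : ℝ) ^ d * boolAvg fun z => |evalBool p z| := by positivity
  have h9 : (9 : ℝ) ^ d = ((3 : ℝ) ^ d) ^ 2 := by
    rw [← pow_mul, mul_comm, pow_mul]
    norm_num
  calc Real.sqrt (boolAvg fun z => evalBool p z ^ 2)
      ≤ Real.sqrt ((9 : ℝ) ^ d * (boolAvg fun z => |evalBool p z|) ^ 2) := Real.sqrt_le_sqrt h
    _ = (3 : ℝ) ^ d * boolAvg fun z => |evalBool p z| := by
        rw [h9, ← mul_pow, Real.sqrt_sq h3]

/-- Averaging a pointwise ℓ¹ bound: `Σ_i |g_i(z)| ≤ L` for every `z` gives `Σ_i E|g_i| ≤ L`. [folklore] -/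
theorem sum_boolAvg_abs_le {ι : Type*} [Fintype ι] (g : ι → MvPolynomial (Fin N) ℝ) {L : ℝ}
    (hl1 : ∀ z, ∑ i, |evalBool (g i) z| ≤ L) :
    ∑ i, boolAvg (fun z => |evalBool (g i) z|) ≤ L := by
  unfold boolAvg
  rw [← Finset.sum_div, Finset.sum_comm]
  have h2N : (0 : ℝ) < (2 : ℝ) ^ N := by positivity
  rw [div_le_iff₀ h2N]
  calc ∑ z : Fin N → Bool, ∑ i, |evalBool (g i) z| ≤ ∑ _z : Fin N → Bool, L :=
        Finset.sum_le_sum fun z _ => hl1 z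
    _ = L * (2 : ℝ) ^ N := by
        simp [Finset.sum_const, Finset.card_univ, Fintype.card_bool, Fintype.card_fin, mul_comm]

/-! ### §2 The heavy-member alternative at exponential scale -/

/-- **Heavy member at exponential scale.** If `g_i` (`i ∈ ι`) are cube polynomials of total degree `≤ d` with
`Σ_i |g_i(z)| ≤ L` for every `z`, and `V := Σ_i E[g_i²] > 0`, then some member has `E[g_i²] ≥ V²/(9^d L²)`.
Proof: with `M := max_i E[g_i²]`, `E[g_i²] = ‖g_i‖₂·‖g_i‖₂ ≤ √M · 3^d E|g_i|`, so `V ≤ √M·3^d·L`.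
(The "one-liner" of the line card: the single moment comparison `‖g‖₂ ≤ 3^d‖g‖₁` summed over the family.)
[cite: ODonnellZhao2016, eqn. (2.1)] -/
theorem exists_heavyMember_exp {ι : Type*} [Fintype ι] {d : ℕ} (g : ι → MvPolynomial (Fin N) ℝ) {L : ℝ}
    (hdeg : ∀ i, (g i).totalDegree ≤ d) (hl1 : ∀ z, ∑ i, |evalBool (g i) z| ≤ L)
    (hV : 0 < ∑ i, boolAvg (fun z => evalBool (g i) z ^ 2)) :
    ∃ i, (∑ i, boolAvg (fun z => evalBool (g i) z ^ 2)) ^ 2 / ((9 : ℝ) ^ d * L ^ 2) ≤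
      boolAvg (fun z => evalBool (g i) z ^ 2) := by
  classical
  set m : ι → ℝ := fun i => boolAvg (fun z => evalBool (g i) z ^ 2) with hm
  set a : ι → ℝ := fun i => boolAvg (fun z => |evalBool (g i) z|) with ha
  have hm0 : ∀ i, 0 ≤ m i := fun i => boolAvg_nonneg fun _ => sq_nonneg _
  have ha0 : ∀ i, 0 ≤ a i := fun i => boolAvg_nonneg fun _ => abs_nonneg _
  -- the index type is nonempty (the total mass is positive)
  have hne : (Finset.univ : Finset ι).Nonempty := by
    rcases (Finset.univ : Finset ι).eq_empty_or_nonempty with h | h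
    · exfalso
      have h0 : ∑ i, m i = 0 := by
        rw [show (Finset.univ : Finset ι) = ∅ from h]
        exact Finset.sum_empty
      exact absurd h0 (ne_of_gt hV)
    · exact h
  obtain ⟨i₀, -, hi₀⟩ := Finset.exists_max_image Finset.univ m hne
  refine ⟨i₀, ?_⟩
  -- `L` is nonnegative as soon as `ι` is nonempty, in fact `Σ_i a_i ≤ L`
  have haL : ∑ i, a i ≤ L := sum_boolAvg_abs_le g hl1
  have hL0 : 0 ≤ L := le_trans (Finset.sum_nonneg fun i _ => ha0 i) haL
  -- termwise: m_i ≤ √M · 3^d · a_i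
  have hterm : ∀ i, m i ≤ Real.sqrt (m i₀) * ((3 : ℝ) ^ d * a i) := by
    intro i
    have h1 : m i = Real.sqrt (m i) * Real.sqrt (m i) := (Real.mul_self_sqrt (hm0 i)).symm
    have h2 : Real.sqrt (m i) ≤ Real.sqrt (m i₀) := Real.sqrt_le_sqrt (hi₀ i (Finset.mem_univ _))
    have h3 : Real.sqrt (m i) ≤ (3 : ℝ) ^ d * a i := sqrt_boolAvg_sq_le (hdeg i)
    calc m i = Real.sqrt (m i) * Real.sqrt (m i) := h1
      _ ≤ Real.sqrt (m i₀) * ((3 : ℝ) ^ d * a i) :=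
          mul_le_mul h2 h3 (Real.sqrt_nonneg _) (Real.sqrt_nonneg _)
  -- summed: V ≤ √M · 3^d · L
  have hsum : ∑ i, m i ≤ Real.sqrt (m i₀) * (3 : ℝ) ^ d * L := by
    calc ∑ i, m i ≤ ∑ i, Real.sqrt (m i₀) * ((3 : ℝ) ^ d * a i) := Finset.sum_le_sum fun i _ => hterm i
      _ = Real.sqrt (m i₀) * (3 : ℝ) ^ d * ∑ i, a i := by
          rw [Finset.mul_sum]
          refine Finset.sum_congr rfl fun i _ => ?_
          ring
      _ ≤ Real.sqrt (m i₀) * (3 : ℝ) ^ d * L :=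
          mul_le_mul_of_nonneg_left haL (by positivity)
  -- squared: V² ≤ M · 9^d · L²
  have hV0 : 0 ≤ ∑ i, m i := hV.le
  have h9 : ((3 : ℝ) ^ d) ^ 2 = (9 : ℝ) ^ d := by
    rw [← pow_mul, mul_comm, pow_mul]
    norm_num
  have hsq : (∑ i, m i) ^ 2 ≤ m i₀ * ((9 : ℝ) ^ d * L ^ 2) := by
    calc (∑ i, m i) ^ 2 ≤ (Real.sqrt (m i₀) * (3 : ℝ) ^ d * L) ^ 2 := pow_le_pow_left₀ hV0 hsum 2
      _ = m i₀ * ((9 : ℝ) ^ d * L ^ 2) := by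
          rw [mul_pow, mul_pow, Real.sq_sqrt (hm0 i₀), h9]
          ring
  -- `L > 0`: otherwise `V ≤ 0`
  have hLpos : 0 < L := by
    rcases lt_or_eq_of_le hL0 with h | h
    · exact h
    · exfalso
      rw [← h, mul_zero] at hsum
      exact absurd hsum (not_le.mpr hV)
  have hden : (0 : ℝ) < (9 : ℝ) ^ d * L ^ 2 := by positivity
  rw [div_le_iff₀ hden]
  exact hsq

/-! ### §3 The registered regime: first alternative of `stub_l1Family` at scale `9^{-d}` -/

/-- **`stub_l1Family`'s first alternative at exponential scale.** In the stub's regime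
`1 ≤ K₀ d^κ₀ Σ_i E[g_i²]` (family `g : Fin N → ℝ[x_1..x_N]`, degrees `≤ d`, `Σ_i |g_i(z)| ≤ 1` pointwise), some
member has `E[g_i²] ≥ 1/(K₀² d^{2κ₀} 9^d)`.  The stub asks for `C/d^c` here or on the coordinate side; this is the
unconditional baseline. [cite: ODonnellZhao2016, eqn. (2.1)] -/
theorem l1Family_heavyMember_expScale (κ₀ : ℕ) {K₀ : ℝ} (hK₀ : 0 < K₀) {N d : ℕ}
    (g : Fin N → MvPolynomial (Fin N) ℝ) (hd : 1 ≤ d) (hdeg : ∀ i, (g i).totalDegree ≤ d)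
    (hl1 : ∀ z, ∑ i, |evalBool (g i) z| ≤ 1)
    (hreg : 1 ≤ K₀ * (d : ℝ) ^ κ₀ * ∑ i, boolAvg (fun z => evalBool (g i) z ^ 2)) :
    ∃ i, 1 / (K₀ ^ 2 * (d : ℝ) ^ (2 * κ₀) * 9 ^ d) ≤ boolAvg (fun z => evalBool (g i) z ^ 2) := by
  set V := ∑ i, boolAvg (fun z => evalBool (g i) z ^ 2) with hVdef
  have hd0 : (0 : ℝ) < (d : ℝ) := by exact_mod_cast hd
  have hKd : 0 < K₀ * (d : ℝ) ^ κ₀ := by positivity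
  have hVge : 1 / (K₀ * (d : ℝ) ^ κ₀) ≤ V := by
    rw [div_le_iff₀ hKd]
    linarith [hreg, mul_comm (K₀ * (d : ℝ) ^ κ₀) V]
  have hVpos : 0 < V := lt_of_lt_of_le (by positivity) hVge
  obtain ⟨i, hi⟩ := exists_heavyMember_exp g hdeg hl1 hVpos
  refine ⟨i, le_trans ?_ hi⟩
  have hsq : 1 / (K₀ ^ 2 * (d : ℝ) ^ (2 * κ₀)) ≤ V ^ 2 := by
    have e : 1 / (K₀ ^ 2 * (d : ℝ) ^ (2 * κ₀)) = (1 / (K₀ * (d : ℝ) ^ κ₀)) ^ 2 := by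
      rw [pow_mul, div_pow, one_pow, mul_pow, ← pow_mul, ← pow_mul, mul_comm κ₀ 2]
    rw [e]
    exact pow_le_pow_left₀ (by positivity) hVge 2
  calc 1 / (K₀ ^ 2 * (d : ℝ) ^ (2 * κ₀) * 9 ^ d)
      = (1 / (K₀ ^ 2 * (d : ℝ) ^ (2 * κ₀))) / ((9 : ℝ) ^ d * 1 ^ 2) := by
        field_simp
    _ ≤ V ^ 2 / ((9 : ℝ) ^ d * 1 ^ 2) := div_le_div_of_nonneg_right hsq (by positivity)

/-- **`stub_l1Family` restricted to bounded degree holds, for EVERY degree cap `D₀`.** The registered statement of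
`stub_l1Family` with the extra hypothesis `d ≤ D₀`, witnessed by `(c, C) := (2κ₀, 1/(K₀² 9^{D₀}))` and the FIRST
alternative (heavy member).  So the stub's entire content is the `d → ∞` dependence: `9^{-d}` versus `d^{-c}`.
[cite: ODonnellZhao2016, eqn. (2.1) and Thm. 2.13] -/
theorem l1Family_of_degree_le (D₀ : ℕ) :
    ∀ (κ₀ : ℕ) (K₀ : ℝ), 0 < K₀ → ∃ (c : ℕ) (C : ℝ), 0 < C ∧
      ∀ (N d : ℕ) (g : Fin N → MvPolynomial (Fin N) ℝ), d ≤ D₀ → 1 ≤ d → (∀ i, (g i).totalDegree ≤ d) →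
        (∀ z, ∑ i, |evalBool (g i) z| ≤ 1) →
        1 ≤ K₀ * (d : ℝ) ^ κ₀ * ∑ i, boolAvg (fun z => evalBool (g i) z ^ 2) →
        (∃ i, C / (d : ℝ) ^ c ≤ boolAvg (fun z => evalBool (g i) z ^ 2)) ∨
        (∃ j, C / (d : ℝ) ^ c ≤
          ∑ i, boolAvg (fun z => (evalBool (g i) z - evalBool (g i) (flipBit j z)) ^ 2)) := by
  intro κ₀ K₀ hK₀
  refine ⟨2 * κ₀, 1 / (K₀ ^ 2 * 9 ^ D₀), by positivity, ?_⟩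
  intro N d g hdD hd hdeg hl1 hreg
  left
  obtain ⟨i, hi⟩ := l1Family_heavyMember_expScale κ₀ hK₀ g hd hdeg hl1 hreg
  refine ⟨i, le_trans ?_ hi⟩
  have hd0 : (0 : ℝ) < (d : ℝ) := by exact_mod_cast hd
  have h9 : (9 : ℝ) ^ d ≤ 9 ^ D₀ := pow_le_pow_right₀ (by norm_num) hdD
  have hdk : (0 : ℝ) < (d : ℝ) ^ (2 * κ₀) := by positivity
  rw [div_div]
  apply one_div_le_one_div_of_le (by positivity)
  calc K₀ ^ 2 * (d : ℝ) ^ (2 * κ₀) * 9 ^ d ≤ K₀ ^ 2 * (d : ℝ) ^ (2 * κ₀) * 9 ^ D₀ :=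
        mul_le_mul_of_nonneg_left h9 (by positivity)
    _ = K₀ ^ 2 * 9 ^ D₀ * (d : ℝ) ^ (2 * κ₀) := by ring

/-! ### §4 Transport to the crux decl `DecoupledCoreAA` through the landed `stub_derivativeFamily` -/

/-- **The decoupled core at exponential scale (unconditional).** Every ONE-BLOCK-DECOUPLED
`q(y,z) = c₀ + Σ_i (±1)^{y_i} g_i(z)` on `Fin (N+N)` that is `[0,1]`-bounded on the cube, of total degree `≤ d`, with
`1 ≤ K₀ d^κ₀ · Var q`, has a `y`-variable of influence `≥ 16/(K₀² d^{2κ₀} 9^d)`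
(`Inf_{y_i} q = 4E[g_i²]`, `Σ_i |g_i| ≤ 1/2`, `Var q = Σ_i E[g_i²]` by `stub_derivativeFamily`; then §2 with `L = 1/2`).
The crux decl `DecoupledCoreAA` asks for `C/d^c`. [cite: ODonnellZhao2016, eqn. (2.1)] -/
theorem decoupledCoreAA_expScale (κ₀ : ℕ) {K₀ : ℝ} (hK₀ : 0 < K₀) {N d : ℕ}
    (q : MvPolynomial (Fin (N + N)) ℝ)
    (hdec : ∃ (c₀ : ℝ) (g : Fin N → (Fin N → Bool) → ℝ), ∀ (y z : Fin N → Bool),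
      evalBool q (Fin.append y z) = c₀ + ∑ i, (if y i then (1 : ℝ) else -1) * g i z)
    (hd : 1 ≤ d) (hdeg : q.totalDegree ≤ d) (hb : ∀ x, 0 ≤ evalBool q x ∧ evalBool q x ≤ 1)
    (hreg : 1 ≤ K₀ * (d : ℝ) ^ κ₀ * boolVariance q) :
    ∃ j : Fin (N + N), 16 / (K₀ ^ 2 * (d : ℝ) ^ (2 * κ₀) * 9 ^ d) ≤ influence j q := by
  obtain ⟨c₀, g, hg⟩ := hdec
  obtain ⟨hl1, hinfy, -, hvar, hpoly⟩ := stub_derivativeFamily N d q c₀ g hg hdeg hb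
  choose r hrdeg hrev using hpoly
  -- the realised family `r` satisfies the hypotheses of §2 with `L = 1/2`
  have hl1' : ∀ z, ∑ i, |evalBool (r i) z| ≤ 1 / 2 := by
    intro z
    simp_rw [hrev]
    exact hl1 z
  have hsq : ∀ i, boolAvg (fun z => evalBool (r i) z ^ 2) = boolAvg (fun z => g i z ^ 2) := by
    intro i
    simp_rw [hrev i]
  set V := ∑ i, boolAvg (fun z => evalBool (r i) z ^ 2) with hVdef
  have hVvar : V = boolVariance q := by
    rw [hvar, hVdef]
    exact Finset.sum_congr rfl fun i _ => hsq i
  have hd0 : (0 : ℝ) < (d : ℝ) := by exact_mod_cast hd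
  have hKd : 0 < K₀ * (d : ℝ) ^ κ₀ := by positivity
  have hVge : 1 / (K₀ * (d : ℝ) ^ κ₀) ≤ V := by
    rw [hVvar, div_le_iff₀ hKd]
    linarith [hreg, mul_comm (K₀ * (d : ℝ) ^ κ₀) (boolVariance q)]
  have hVpos : 0 < V := lt_of_lt_of_le (by positivity) hVge
  obtain ⟨i, hi⟩ := exists_heavyMember_exp r hrdeg hl1' hVpos
  refine ⟨Fin.castAdd N i, ?_⟩
  rw [hinfy i, ← hsq i]
  have hsq2 : 1 / (K₀ ^ 2 * (d : ℝ) ^ (2 * κ₀)) ≤ V ^ 2 := by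
    have e : 1 / (K₀ ^ 2 * (d : ℝ) ^ (2 * κ₀)) = (1 / (K₀ * (d : ℝ) ^ κ₀)) ^ 2 := by
      rw [pow_mul, div_pow, one_pow, mul_pow, ← pow_mul, ← pow_mul, mul_comm κ₀ 2]
    rw [e]
    exact pow_le_pow_left₀ (by positivity) hVge 2
  have h9 : (0 : ℝ) < (9 : ℝ) ^ d := by positivity
  calc 16 / (K₀ ^ 2 * (d : ℝ) ^ (2 * κ₀) * 9 ^ d)
      = 4 * ((1 / (K₀ ^ 2 * (d : ℝ) ^ (2 * κ₀))) / ((9 : ℝ) ^ d * (1 / 2) ^ 2)) := by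
        field_simp
        ring
    _ ≤ 4 * (V ^ 2 / ((9 : ℝ) ^ d * (1 / 2) ^ 2)) := by
        have := div_le_div_of_nonneg_right hsq2 (by positivity : (0 : ℝ) ≤ (9 : ℝ) ^ d * (1 / 2) ^ 2)
        linarith
    _ ≤ 4 * boolAvg (fun z => evalBool (r i) z ^ 2) := by linarith [hi]

/-- **The crux decl `DecoupledCoreAA` restricted to bounded degree holds, for EVERY degree cap `D₀`**
(`(c, C) := (2κ₀, 16/(K₀² 9^{D₀}))`).  The decl itself (all `d` at once with `C/d^c`) is the open core.
[cite: ODonnellZhao2016, Thm. 2.13] -/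
theorem decoupledCoreAA_of_degree_le (D₀ : ℕ) :
    ∀ (κ₀ : ℕ) (K₀ : ℝ), 0 < K₀ → ∃ (c : ℕ) (C : ℝ), 0 < C ∧
      ∀ (N d : ℕ) (q : MvPolynomial (Fin (N + N)) ℝ),
        (∃ (c₀ : ℝ) (g : Fin N → (Fin N → Bool) → ℝ), ∀ (y z : Fin N → Bool),
          evalBool q (Fin.append y z) = c₀ + ∑ i, (if y i then (1 : ℝ) else -1) * g i z) →
        d ≤ D₀ → 1 ≤ d → q.totalDegree ≤ d → (∀ x, 0 ≤ evalBool q x ∧ evalBool q x ≤ 1) →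
        1 ≤ K₀ * (d : ℝ) ^ κ₀ * boolVariance q →
        ∃ j : Fin (N + N), C / (d : ℝ) ^ c ≤ influence j q := by
  intro κ₀ K₀ hK₀
  refine ⟨2 * κ₀, 16 / (K₀ ^ 2 * 9 ^ D₀), by positivity, ?_⟩
  intro N d q hdec hdD hd hdeg hb hreg
  obtain ⟨j, hj⟩ := decoupledCoreAA_expScale κ₀ hK₀ q hdec hd hdeg hb hreg
  refine ⟨j, le_trans ?_ hj⟩
  have hd0 : (0 : ℝ) < (d : ℝ) := by exact_mod_cast hd
  have h9 : (9 : ℝ) ^ d ≤ 9 ^ D₀ := pow_le_pow_right₀ (by norm_num) hdD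
  rw [div_div]
  apply div_le_div_of_nonneg_left (by norm_num) (by positivity)
  calc K₀ ^ 2 * (d : ℝ) ^ (2 * κ₀) * 9 ^ d ≤ K₀ ^ 2 * (d : ℝ) ^ (2 * κ₀) * 9 ^ D₀ :=
        mul_le_mul_of_nonneg_left h9 (by positivity)
    _ = K₀ ^ 2 * 9 ^ D₀ * (d : ℝ) ^ (2 * κ₀) := by ring

end Summit.QuantumAdvantage.QuantumAdvantage.Cruxes.DecoupledCoreAA.L1Family.ExpRung

end
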